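import Mathlib
import HarnessLib
import Summits.MatrixMultiplication.MatrixMultiplication.Theorems.OutsiderSandwichPolystableRigidity
import Summits.MatrixMultiplication.MatrixMultiplication.Theorems.OutsiderSandwichCwTwoPowPolystable
import Summits.MatrixMultiplication.MatrixMultiplication.Theorems.OutsiderSandwichNoExactPerfection

/-!
# OutsiderSandwich — NO EXACT PERFECT DEGENERATION of the `cw₂`-tower (the lens' extremal cells)

Route `OutsiderSandwich` (decomp-mm lens 4 «minimal counterexample / extremal reduction», gen 32).

The minimal-counterexample ledger of the cell asks, cell by cell, whether `cw₂^{⊠N}` degenerates to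
a matrix product filling its format EXACTLY (`m² = 3^N`: `(N,m) = (2,3), (4,9), (6,27), …`; the
`(2,3)` cell is the tree's `MMThreeNotInCwTwoPowTwo`, by border rank `17 > 16`; the `(4,9)` cell was
OPEN for degenerations — border rank needs `R̲(cw₂^{⊠4}) < R̲⟨9,9,9⟩`, unknown). Both `cw₂^{⊠N}`
(`isPolystableTensor_cwTwoPow`) and `⟨m,m,m⟩` (BI 2017 Cor. 4.9, tree
`BurgisserIkenmeyer2017_cor49_matMulTensor_holds`) are POLYSTABLE, so by Kempf–Ness rigidity
(`restrictsTo_and_of_degeneratesTo`) an exact perfect DEGENERATION would be an exact perfect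
RESTRICTION, which the tree's `CwTwoNoExactPerfection` (`cwTwoNoExactPerfection_holds`: `m² < 3^N`
for `⟨m,m,m⟩ ≤ cw₂^{⊠N}`, support functionals) forbids:

* `cwTwoPow_not_degeneratesTo_matMul`: for every `N ≥ 1`, every `m` and EVERY identification `e`
  of the formats, `¬ (cw₂^{⊠N} ⊵ e^*⟨m,m,m⟩)` (orbit-closure degeneration, CVZ Rem. 1.2);
* the cells `(4,9)` and `(6,27)`: `cwTwoPowFour_not_degeneratesTo_matMulNine`,
  `cwTwoPowSix_not_degeneratesTo_matMulTwentySeven`.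

So TOP (`CwTwoMMPerfect`, rate `m^{2/N} → 3`) is a supremum attained at NO finite level even in the
degeneration order, not only in the restriction order: every witness ladder for TOP is a genuine
limit. (The instrument is silent on NON-exact cells `m² < 3^N`, e.g. `(3,5)`, `(4,8)`: a padded
target `⟨m,m,m⟩ ⊕ 0` is unstable, not polystable.)

## References

* G. Kempf, L. Ness, *The length of vectors in representation spaces*, LNM 732 (1979), Thm. 0.2.
  [KempfNess1979]
* P. Bürgisser, C. Ikenmeyer, *Fundamental invariants of orbit closures*, J. Algebra 477 (2017),
  §4.2, Cor. 4.9. [BurgisserIkenmeyer2017]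
* M. Christandl, P. Vrana, J. Zuiddam, *Universal points in the asymptotic spectrum of tensors*,
  J. AMS 36 (2023), Rem. 1.2. [ChristandlVranaZuiddam2023]
-/

noncomputable section

open Literature.Computability.AlgebraicComplexity

namespace Summit.MatrixMultiplication.MatrixMultiplication.Theorems.OutsiderSandwichNoPerfectDegeneration

open OutsiderSandwichPolystableRigidity OutsiderSandwichCwTwoPowPolystable

/-! ## The route's cells: no exact perfect degeneration of the `cw₂`-tower -/

section Cells

/-- A relabelled matrix multiplication tensor `⟨m,m,m⟩`, `m ≥ 1`, is nonzero. [folklore] -/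
theorem relabel_matMulTensor_ne_zero {ι' : Type*} {m : ℕ}
    (hm : 0 < m) (e : ι' ≃ (Fin m × Fin m)) :
    (fun a b c => matMulTensor ℂ m m m (e a) (e b) (e c)) ≠ 0 := by
  intro h0
  have h := congrFun (congrFun (congrFun h0 (e.symm (⟨0, hm⟩, ⟨0, hm⟩))) (e.symm (⟨0, hm⟩, ⟨0, hm⟩)))
    (e.symm (⟨0, hm⟩, ⟨0, hm⟩))
  simp [matMulTensor] at h

/-- **No exact perfect DEGENERATION of the `cw₂`-tower.** For every `N ≥ 1`, every `m` and every
identification `e` of the format of `⟨m,m,m⟩` with that of `cw₂^{⊠N}` (these exist iff `m² = 3^N`),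
`cw₂^{⊠N}` does NOT degenerate (orbit closure) to `⟨m,m,m⟩`: both tensors are polystable, so a
degeneration would be a restriction (`restrictsTo_and_of_degeneratesTo`), contradicting the tree's
`CwTwoNoExactPerfection` (`m² < 3^N` for restrictions). [cite: KempfNess1979, Thm. 0.2;
BurgisserIkenmeyer2017, Cor. 4.9] -/
theorem cwTwoPow_not_degeneratesTo_matMul (N m : ℕ) (hN : 1 ≤ N)
    (e : (Fin N → Fin 3) ≃ (Fin m × Fin m)) :
    ¬ TensorDegeneratesTo (kroneckerPow (cwTensor ℂ 2) N)
      (fun a b c => matMulTensor ℂ m m m (e a) (e b) (e c)) := by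
  have hcard : 3 ^ N = m * m := by simpa using Fintype.card_congr e
  have hm : 0 < m := by
    rcases Nat.eq_zero_or_pos m with rfl | hm
    · exact absurd hcard (by positivity)
    · exact hm
  intro hdeg
  have hP₀ : IsPolystableTensor (kroneckerPow (cwTensor ℂ 2) N) := isPolystableTensor_cwTwoPow N
  have hP₁ : IsPolystableTensor (fun a b c => matMulTensor ℂ m m m (e a) (e b) (e c)) :=
    isPolystableTensor_relabel e
      (BurgisserIkenmeyer2017_cor49_matMulTensor_iff.mp BurgisserIkenmeyer2017_cor49_matMulTensor_holds m)
  have hres : TensorRestrictsTo (kroneckerPow (cwTensor ℂ 2) N) (matMulTensor ℂ m m m) :=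
    tensorRestrictsTo_of_relabel e
      (restrictsTo_and_of_degeneratesTo hdeg hP₀ hP₁ (relabel_matMulTensor_ne_zero hm e)).1
  have hlt : m ^ 2 < 3 ^ N :=
    OutsiderSandwichNoExactPerfection.cwTwoNoExactPerfection_holds N m hN hres
  rw [sq, ← hcard] at hlt
  exact lt_irrefl _ hlt

/-- **The `(4,9)` cell is closed for degenerations**: `cw₂^{⊠4} ⋭ ⟨9,9,9⟩` (`81 = 81` formats),
for every identification of the formats. [cite: KempfNess1979, Thm. 0.2] -/
theorem cwTwoPowFour_not_degeneratesTo_matMulNine (e : (Fin 4 → Fin 3) ≃ (Fin 9 × Fin 9)) :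
    ¬ TensorDegeneratesTo (kroneckerPow (cwTensor ℂ 2) 4)
      (fun a b c => matMulTensor ℂ 9 9 9 (e a) (e b) (e c)) :=
  cwTwoPow_not_degeneratesTo_matMul 4 9 (by norm_num) e

/-- **The `(6,27)` cell is closed for degenerations**: `cw₂^{⊠6} ⋭ ⟨27,27,27⟩` (`729 = 729`).
[cite: KempfNess1979, Thm. 0.2] -/
theorem cwTwoPowSix_not_degeneratesTo_matMulTwentySeven
    (e : (Fin 6 → Fin 3) ≃ (Fin 27 × Fin 27)) :
    ¬ TensorDegeneratesTo (kroneckerPow (cwTensor ℂ 2) 6)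
      (fun a b c => matMulTensor ℂ 27 27 27 (e a) (e b) (e c)) :=
  cwTwoPow_not_degeneratesTo_matMul 6 27 (by norm_num) e

end Cells

end Summit.MatrixMultiplication.MatrixMultiplication.Theorems.OutsiderSandwichNoPerfectDegeneration

end
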